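import Summits.AtomisticToContinuum.Crystallization.Theorems.TornFree.Negative.TolFamily

/-!
# `TornFree` (stmt-AtomisticToContinuum-18069), negative side: TIGHTNESS of the constant `4` and
# non-vacuity of the hypotheses

Instantiates the periodic integer certificate replayer of `TolFamily.lean` (`Cert`, `cert_model`) on a
`2.04 %`-strained face-centred cubic lattice (conventional cube of edge `70`, scale `D = 50`,
nearest-neighbour distance `35√2 ≈ 0.99 D`, next distance `70 = 1.4 D > 1.26 D`): EVERY site of this
infinite set is gapped-twelve at `(a, 1/50, 63/50)` and a bond has EXACTLY four common bonded
neighbours (`tornFree_tight`, in the verbatim spelling of the crux hypothesis).  So the hypotheses of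
`GappedShellCensus.TornFree` are consistent (the crux is not vacuously true) and its conclusion
`4 ≤ #commons` cannot be strengthened to `5 ≤`.  Refuter seat
refuter-cdisprove-stmt-AtomisticToContinuum-18069-0, 2026-08-17; no route item is concluded positively.
-/

noncomputable section

namespace Summit.AtomisticToContinuum.Crystallization.Theorems.TornFree.Negative

open Literature.Geometry.DiscreteGeometry

/-- Box of the strained face-centred cubic certificate (conventional cube of edge `70`, in units in
which the scale is `D = 50`; nearest-neighbour distance `35√2 ≈ 49.5 = 0.99 D`) (search data, not a
literature fact). -/
def fccL : Fin 3 → ℤ := ![70, 70, 70]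

/-- Motif of the strained fcc certificate: the four points of the conventional cell (search data,
not a literature fact). -/
def fccP : Fin 4 → Fin 3 → ℤ := ![![0, 0, 0], ![35, 35, 0], ![35, 0, 35], ![0, 35, 35]]

set_option maxRecDepth 4000 in
/-- The strained fcc configuration is a periodic certificate at `(lo2, hi2, gam2) = (49², 51², 63²)`,
i.e. scale `D = 50`, `τ = 1/50`, `γ = 63/50`. [folklore] -/
theorem fcc_cert : Cert 4 fccL fccP 2401 2601 3969 :=
  ⟨by decide, by decide, by decide, by decide, by decide, by decide, by decide⟩

/-- In the strained fcc certificate the bond `P 0 — P 1` has exactly four common neighbours.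
[folklore] -/
theorem fcc_commonIdx_card : (commonIdx fccL fccP 2601 0 1 13).card = 4 := by decide

/-- The motif points `P 0`, `P 1` of the fcc certificate are bonded. -/
theorem fcc_bond : sqd fccL fccP 0 1 (off27 13) ≤ 2601 := by decide

/-- **Tightness and non-vacuity of the crux family at `(1/50, 63/50)`.**  There is an infinite
configuration (a strained fcc lattice) in which EVERY site is gapped-twelve at `(a, 1/50, 63/50)` and
some bond has EXACTLY four common bonded neighbours: the hypotheses of `TornFree` are satisfiable and
its constant `4` cannot be improved. [folklore] -/
theorem tornFreeTol_tight :
    ∃ (Y : Set (EuclideanSpace ℝ (Fin 3))) (a : ℝ), 0 < a ∧ Y.Infinite ∧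
      (∀ y ∈ Y, GappedTwelveAt (1 / 50) (63 / 50) Y a y) ∧
      ∃ y ∈ Y, ∃ v ∈ Y, v ≠ y ∧ dist y v ≤ a * (1 + 1 / 50) ∧
        (commons (1 / 50) Y a y v).ncard = 4 := by
  obtain ⟨hinf, hall, hb⟩ := cert_model fcc_cert (1 / 50) (63 / 50) 50 (by norm_num)
    (by norm_num) (by norm_num) (by norm_num) (by norm_num) (by norm_num) (by norm_num)
  obtain ⟨hy, hv, hvy, hdist, hcount⟩ := hb 0 1 13 (by decide)
  refine ⟨perSet fccL fccP, (50 : ℕ), by norm_num, hinf (by norm_num), hall, _, hy, _, hv, hvy,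
    hdist.2 fcc_bond, ?_⟩
  rw [hcount, fcc_commonIdx_card]

/-- The same fact in the verbatim spelling of the crux `GappedShellCensus.TornFree`: its hypothesis
is satisfied by an infinite `Y` at some scale `a > 0` while a bond has exactly four common bonded
neighbours (the conclusion `4 ≤ …` is attained with equality). [folklore] -/
theorem tornFree_tight :
    ∃ (Y : Set (EuclideanSpace ℝ (Fin 3))) (a : ℝ), 0 < a ∧ Y.Infinite ∧
      (∀ y ∈ Y, ({w ∈ Y | w ≠ y ∧ dist y w ≤ a * (1 + 1 / 50)}.ncard = 12 ∧
        ∀ w ∈ Y, w ≠ y → a * (1 - 1 / 50) ≤ dist y w ∧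
          (dist y w ≤ a * (1 + 1 / 50) ∨ a * (63 / 50) ≤ dist y w))) ∧
      ∃ y ∈ Y, ∃ v ∈ Y, v ≠ y ∧ dist y v ≤ a * (1 + 1 / 50) ∧
        {w ∈ Y | w ≠ y ∧ w ≠ v ∧ dist y w ≤ a * (1 + 1 / 50) ∧
          dist v w ≤ a * (1 + 1 / 50)}.ncard = 4 :=
  tornFreeTol_tight

end Summit.AtomisticToContinuum.Crystallization.Theorems.TornFree.Negative

end
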